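import Mathlib.RingTheory.WittVector.Isocrystal
import Mathlib.FieldTheory.IsAlgClosed.Basic
import Mathlib.FieldTheory.Galois.Basic
import Mathlib.FieldTheory.Perfect
import Mathlib.RepresentationTheory.Basic
import Mathlib.RingTheory.TensorProduct.Basic
import Mathlib.LinearAlgebra.FreeModule.Basic
import HarnessLib

/-!
# Kottwitz (1992), §12 — Equality of two functorial isomorphisms from `X_*(T)_Γ` to `B(T)` (pp. 412–414):
# the characterization of `f`, the reduction step, and Lemma 12.1 as named facts

Carpet file of squad TK (cell `hodgecm-mathlib`), source [Kottwitz1992] = R. E. Kottwitz, *Points on some Shimura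
varieties over finite fields*, J. Amer. Math. Soc. **5** (1992) 373–444, §12, printed pp. 412–414 (held text
`paper:doi-10-2307-2152772`, p0040–p0042).  STATEMENTS ONLY (typer lint rule): named facts `def … : Prop`, interface
definitions with bodies; no proof, no `sorry`, no `axiom`, no `instance`, no notation.

## The setting (p. 412) and the model used here

«Let `K` be a finite Galois extension of `ℚ_p` contained in some algebraic closure `ℚ̄_p` of `ℚ_p`. Let `K^un`
denote the maximal unramified extension of `K` in `ℚ̄_p`, and let `L` denote the completion of the maximal
unramified extension of `ℚ_p` in `ℚ̄_p`. Write `Γ` for the Galois group `Gal(ℚ̄_p/ℚ_p)` and `σ` for the Frobenius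
automorphism of `L` over `ℚ_p`. Consider the category `𝒯` of tori `T` over `ℚ_p` that are split by `K`. The functor
`T ↦ X^*(T)` is an equivalence of categories between `𝒯` and the category of `Gal(K/ℚ_p)`-modules that are free of
finite rank as abelian groups. The functor `T ↦ X_*(T)` is represented by the torus `R_{K/ℚ_p} 𝔾_m` and the …
cocharacter `μ_univ` … As in [K3] for any `T ∈ 𝒯` we write `B(T)` for the group `T(L)/{t σ(t)⁻¹ | t ∈ T(L)}`.»

MODEL (the printed equivalence `𝒯 ≃ Gal(K/ℚ_p)`-lattices is taken as the definition of `𝒯`):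
* `ℚ_p`, `L`, `σ`: a field `Q`, a field `L` with `Algebra Q L` and `σ : L ≃ₐ[Q] L`, tied to the printed objects by
  the hypothesis `IsLDatum p k Q L σ eL`: `k` is an algebraic closure of `𝔽_p` (algebraically closed and every
  element satisfies `x^{p^n} = x` for some `n ≥ 1`), `eL : L ≃+* K(p, k)` identifies `L` with the fraction field of
  the Witt ring `W(k)` (Mathlib `FractionRing (WittVector p k)`, = the completion of `ℚ_p^un`) carrying `σ` to the
  Witt-vector Frobenius, and `Q = L^σ` (every `σ`-fixed element of `L` is in `Q`; `(ℚ_p^un)^∧` has `σ`-fixed field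
  `ℚ_p` [folklore]).  `K`: a field, `Algebra Q K`, `FiniteDimensional Q K`, `IsGalois Q K`; `G := K ≃ₐ[Q] K`.
* A torus `T ∈ 𝒯` is its cocharacter lattice `Y = X_*(T)` (a finitely generated free `ℤ`-module) with the
  `G`-action `ρ : Representation ℤ G Y`; morphisms of `𝒯` are `G`-equivariant `ℤ`-linear maps.
* `T(L) = (X_*(T) ⊗_ℤ (L ⊗_{ℚ_p} K)^×)^{Gal(K/ℚ_p)}` (Galois descent from `T_K = X_*(T) ⊗ 𝔾_m`): the `ℤ`-submodule
  `TL` of `M(Y) := Y ⊗[ℤ] Additive (L ⊗[Q] K)ˣ` fixed by `g ↦ ρ(g) ⊗ (1 ⊗ g)`; `σ` acts on `M(Y)` through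
  `σ ⊗ 1` on `L ⊗ K` (`sigmaM`); `(σ - 1) T(L)` is `NY`; `B(T) = T(L)/(σ-1)T(L)` is typed as the image `BT` of `TL`
  in the quotient `BigQ := M(Y) ⧸ NY` (so that classes `[t]`, `t ∈ M(Y)`, can be formed without membership proofs).
* `𝔾_m` is `(ℤ, trivial)`; «the element of `B(𝔾_m)` represented by `p ∈ L^× = 𝔾_m(L)`» is `pClass u` for a unit
  `u : Lˣ` with `(u : L) = p` (a hypothesis), i.e. the class of `1 ⊗ (p ⊗ 1)`.
* «A map of set-valued functors `X_*(·) → B(·)` on `𝒯`» is a family `η Y ρ : Y → BigQ Y ρ` with values in `BT`,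
  natural for `G`-maps `φ : Y → Y'` in the sense that `B(φ) = [φ ⊗ 1]` carries `η_Y(y)` to `η_{Y'}(φ y)`
  (`IsNatural`); «a homomorphism of functors `X_*(·)_Γ → B(·)`» is an additive such family constant on `G`-orbits
  (`IsAdditiveOnCoinvariants`; `Γ` acts on `X_*(T)` through `Gal(K/ℚ_p)`).

## What is typed, and faithfulness notes

* `Kottwitz1992_12_kottwitzMap_characterization` — the printed characterization of the isomorphism `f` of [K3] §2
  (p. 412, unnumbered but load-bearing): there is exactly one homomorphism of functors `X_*(·)_Γ → B(·)` on `𝒯`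
  sending `1 ∈ ℤ = X_*(𝔾_m)_Γ` to `[p]`, and it is an isomorphism of functors («the methods of §2 of [K3] still apply
  and yield the characterization above», p. 413).
* `Kottwitz1992_12_1_reduction` — the reduction printed in the proof of Lemma 12.1 (p. 414): two maps of set-valued
  functors `X_*(·) → B(·)` on `𝒯` that agree on `1 ∈ X_*(𝔾_m)` are equal («it is enough to check that `fq` and `g`
  agree on `μ_univ` … the norm map … induces an isomorphism `B(R_{K/ℚ_p}𝔾_m) → B(𝔾_m)`. Therefore it is enough to
  check that `fq` and `g` agree on `1 ∈ ℤ = X_*(𝔾_m)`»).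
* `Kottwitz1992_12_1` — «**Lemma 12.1.** The map of functors `g : X_*(·) → B(·)` is the negative of the composition
  of `q : X_*(·) → X_*(·)_Γ` and `f : X_*(·)_Γ → B(·)`.»  The CONSTRUCTION of `g` (pp. 413–414: `μ ↦ h : R_{K/ℚ_p}𝔾_m → T`,
  local class field theory with Deligne's normalization, the Fontaine–Messing functor from crystalline
  representations of `Gal(ℚ̄_p/K^un)` to `Φ`-isocrystals, the non-standard fibre functor on `Rep(T)` over `L`,
  Steinberg's theorem `H¹(L, T) = 0`, `Φ_V = b_V σ`) is NOT typable over Mathlib (no crystalline representations /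
  Fontaine–Messing functor): `g` enters as an arbitrary map of set-valued functors together with the hypothesis
  that is the printed outcome of that construction on the Tate object, «we conclude that `b` is represented by
  `p⁻¹ ∈ 𝔾_m(L)`» (p. 414), i.e. `g_{𝔾_m}(1) = [p⁻¹] = -[p]`; `f` enters through its printed characterization.
  So the typed Lemma 12.1 is: for every such `f` and `g`, `g = -(f ∘ q)` on every `T ∈ 𝒯` — which, given the two
  facts above, is exactly the printed proof's content.
  -- TODO(general form): the Fontaine–Messing construction of `g` itself (pp. 413–414).
* Universe: all carrier types in `Type`.

## References

* [Kottwitz1992] §12, pp. 412–414.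
* [Kottwitz1985Isocrystals] R. E. Kottwitz, *Isocrystals with additional structure*, Compositio Math. 56 (1985)
  201–220, §2 (= the paper's [K3]; the functorial isomorphism `X_*(T)_Γ → B(T)`).
-/

noncomputable section

open scoped Isocrystal TensorProduct
open WittVector

namespace Literature.NumberTheory.Kottwitz1992.FunctorialIsomorphisms

section Model

variable (p : ℕ) [Fact p.Prime] (k : Type) [Field k] [CharP k p] [IsAlgClosed k]
variable (Q : Type) [Field Q] (L : Type) [Field L] [Algebra Q L] (σ : L ≃ₐ[Q] L)

/-- `(Q, L, σ)` is `(ℚ_p, L, σ)` of p. 412: `k` is an algebraic closure of `𝔽_p` (every element lies in a finite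
field), `eL` identifies `L` with `Frac W(k)` = the completion of the maximal unramified extension of `ℚ_p`, carrying
`σ` to the Frobenius, and `Q ⊂ L` is the fixed field of `σ`, i.e. `ℚ_p`. [cite: Kottwitz1992, §12 (p. 412)] [folklore] -/
def IsLDatum (eL : L ≃+* K(p, k)) : Prop :=
  (∀ x : k, ∃ n : ℕ, 0 < n ∧ x ^ p ^ n = x) ∧
    (∀ x : L, eL (σ x) = WittVector.FractionRing.frobenius p k (eL x)) ∧
    (∀ x : L, σ x = x → x ∈ Set.range (algebraMap Q L))

variable (K : Type) [Field K] [Algebra Q K]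

/-- The action of `g ∈ Gal(K/ℚ_p)` on `(L ⊗_{ℚ_p} K)^×` through the factor `K`, written additively and `ℤ`-linearly.
[cite: Kottwitz1992, §12 (p. 412)] -/
def unitsGalAct (g : K ≃ₐ[Q] K) : Additive (L ⊗[Q] K)ˣ →ₗ[ℤ] Additive (L ⊗[Q] K)ˣ :=
  (MonoidHom.toAdditive
    (Units.map (Algebra.TensorProduct.map (AlgHom.id Q L) (g : K →ₐ[Q] K)).toMonoidHom)).toIntLinearMap

/-- The action of the Frobenius `σ` on `(L ⊗_{ℚ_p} K)^×` through the factor `L`, written additively.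
[cite: Kottwitz1992, §12 (p. 412)] -/
def unitsFrob : Additive (L ⊗[Q] K)ˣ →ₗ[ℤ] Additive (L ⊗[Q] K)ˣ :=
  (MonoidHom.toAdditive
    (Units.map (Algebra.TensorProduct.map (σ : L →ₐ[Q] L) (AlgHom.id Q K)).toMonoidHom)).toIntLinearMap

variable (Y : Type) [AddCommGroup Y] (ρ : Representation ℤ (K ≃ₐ[Q] K) Y)

/-- The diagonal action of `g ∈ Gal(K/ℚ_p)` on `M(Y) = X_*(T) ⊗_ℤ (L ⊗_{ℚ_p} K)^×` (on `X_*(T)` by `ρ`, on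
`L ⊗ K` through `K`), whose fixed points are `T(L)`. [cite: Kottwitz1992, §12 (p. 412)] -/
def galAct (g : K ≃ₐ[Q] K) : Y ⊗[ℤ] Additive (L ⊗[Q] K)ˣ →ₗ[ℤ] Y ⊗[ℤ] Additive (L ⊗[Q] K)ˣ :=
  TensorProduct.map (ρ g) (unitsGalAct Q L K g)

/-- `T(L) = (X_*(T) ⊗ (L ⊗_{ℚ_p} K)^×)^{Gal(K/ℚ_p)}`, the `L`-points of the torus `T ∈ 𝒯` with cocharacter module
`(Y, ρ)` (Galois descent from the split torus `T_K = X_*(T) ⊗ 𝔾_m`). [cite: Kottwitz1992, §12 (p. 412)] -/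
def TL : Submodule ℤ (Y ⊗[ℤ] Additive (L ⊗[Q] K)ˣ) :=
  ⨅ g : K ≃ₐ[Q] K, LinearMap.ker (galAct Q L K Y ρ g - LinearMap.id)

/-- The Frobenius `σ` of `L` acting on `M(Y) = X_*(T) ⊗ (L ⊗_{ℚ_p} K)^×` (through `L`); it preserves `T(L)`.
[cite: Kottwitz1992, §12 (p. 412)] -/
def sigmaM : Y ⊗[ℤ] Additive (L ⊗[Q] K)ˣ →ₗ[ℤ] Y ⊗[ℤ] Additive (L ⊗[Q] K)ˣ :=
  TensorProduct.map LinearMap.id (unitsFrob Q L σ K)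

/-- The subgroup `{t σ(t)⁻¹ | t ∈ T(L)} = (σ - 1) T(L)` (written additively). [cite: Kottwitz1992, §12 (p. 412)] -/
def NY : Submodule ℤ (Y ⊗[ℤ] Additive (L ⊗[Q] K)ˣ) :=
  Submodule.map (sigmaM Q L σ K Y - LinearMap.id) (TL Q L K Y ρ)

/-- The ambient quotient `M(Y) ⧸ (σ - 1) T(L)` in which `B(T)` lives (classes `[t]` of all `t ∈ M(Y)`).
[cite: Kottwitz1992, §12 (p. 412)] -/
abbrev BigQ : Type :=
  (Y ⊗[ℤ] Additive (L ⊗[Q] K)ˣ) ⧸ NY Q L σ K Y ρ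

/-- `B(T) = T(L)/{t σ(t)⁻¹ | t ∈ T(L)}` («As in [K3] …», p. 412), as the image of `T(L)` in `BigQ`.
[cite: Kottwitz1992, §12 (p. 412)] [cite: Kottwitz1985Isocrystals, §2] -/
def BT : Submodule ℤ (BigQ Q L σ K Y ρ) :=
  Submodule.map (NY Q L σ K Y ρ).mkQ (TL Q L K Y ρ)

/-- The torus `𝔾_m ∈ 𝒯`: cocharacter module `ℤ` with trivial `Gal(K/ℚ_p)`-action. [cite: Kottwitz1992, §12 (p. 412)] -/
abbrev gmRep : Representation ℤ (K ≃ₐ[Q] K) ℤ :=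
  Representation.trivial ℤ (K ≃ₐ[Q] K) ℤ

/-- «The element of `B(𝔾_m)` represented by `p ∈ L^× = 𝔾_m(L)`» — for a unit `u` of `L` (used with `(u : L) = p`):
the class of `1 ⊗ (u ⊗ 1)`. [cite: Kottwitz1992, §12 (p. 412)] -/
def pClass (u : Lˣ) : BigQ Q L σ K ℤ (gmRep Q K) :=
  (NY Q L σ K ℤ (gmRep Q K)).mkQ
    ((1 : ℤ) ⊗ₜ Additive.ofMul
      (Units.map (Algebra.TensorProduct.includeLeft : L →ₐ[Q] L ⊗[Q] K).toMonoidHom u))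

/-- «A map of set-valued functors `X_*(·) → B(·)` on `𝒯`»: a family `η_T : X_*(T) → B(T)` (values in `B(T) ⊂ BigQ`)
natural in `T ∈ 𝒯`: for every `Gal(K/ℚ_p)`-equivariant `φ : X_*(T) → X_*(T')` between cocharacter lattices and
every `y`, the map `B(T) → B(T')` induced by `φ ⊗ 1` carries `η_T(y)` to `η_{T'}(φ y)` (stated on representatives
`t ∈ T(L)`). [cite: Kottwitz1992, §12 (p. 414)] -/
def IsNatural
    (η : ∀ (Y : Type) [AddCommGroup Y] (ρ : Representation ℤ (K ≃ₐ[Q] K) Y), Y → BigQ Q L σ K Y ρ) : Prop :=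
  (∀ (Y : Type) [AddCommGroup Y] [Module.Finite ℤ Y] [Module.Free ℤ Y] (ρ : Representation ℤ (K ≃ₐ[Q] K) Y)
      (y : Y), η Y ρ y ∈ BT Q L σ K Y ρ) ∧
    ∀ (Y Y' : Type) [AddCommGroup Y] [Module.Finite ℤ Y] [Module.Free ℤ Y] [AddCommGroup Y'] [Module.Finite ℤ Y']
      [Module.Free ℤ Y'] (ρ : Representation ℤ (K ≃ₐ[Q] K) Y) (ρ' : Representation ℤ (K ≃ₐ[Q] K) Y')
      (φ : Y →ₗ[ℤ] Y'), (∀ g, φ ∘ₗ ρ g = ρ' g ∘ₗ φ) →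
      ∀ (y : Y) (t : Y ⊗[ℤ] Additive (L ⊗[Q] K)ˣ), t ∈ TL Q L K Y ρ →
        (NY Q L σ K Y ρ).mkQ t = η Y ρ y →
          (NY Q L σ K Y' ρ').mkQ (TensorProduct.map φ LinearMap.id t) = η Y' ρ' (φ y)

/-- «A homomorphism of functors `X_*(·)_Γ → B(·)`» on `𝒯`, as a family on `X_*(·)`: additive and constant on
`Gal(K/ℚ_p)`-orbits (so that it factors through the coinvariants `X_*(T)_Γ`; `Γ` acts on `X_*(T)` through
`Gal(K/ℚ_p)`). [cite: Kottwitz1992, §12 (p. 412)] -/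
def IsAdditiveOnCoinvariants
    (η : ∀ (Y : Type) [AddCommGroup Y] (ρ : Representation ℤ (K ≃ₐ[Q] K) Y), Y → BigQ Q L σ K Y ρ) : Prop :=
  ∀ (Y : Type) [AddCommGroup Y] [Module.Finite ℤ Y] [Module.Free ℤ Y] (ρ : Representation ℤ (K ≃ₐ[Q] K) Y),
    (∀ y y' : Y, η Y ρ (y + y') = η Y ρ y + η Y ρ y') ∧ ∀ (g : K ≃ₐ[Q] K) (y : Y), η Y ρ (ρ g y) = η Y ρ y

/-- The family `η` induces, for every `T ∈ 𝒯`, a bijection `X_*(T)_Γ → B(T)`: it is onto `B(T)` and (being additive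
and constant on orbits) its kernel is exactly the span of the `γ y - y`. [cite: Kottwitz1992, §12 (p. 412)] -/
def IsIsoOnCoinvariants
    (η : ∀ (Y : Type) [AddCommGroup Y] (ρ : Representation ℤ (K ≃ₐ[Q] K) Y), Y → BigQ Q L σ K Y ρ) : Prop :=
  ∀ (Y : Type) [AddCommGroup Y] [Module.Finite ℤ Y] [Module.Free ℤ Y] (ρ : Representation ℤ (K ≃ₐ[Q] K) Y),
    (∀ b ∈ BT Q L σ K Y ρ, ∃ y : Y, η Y ρ y = b) ∧
      ∀ y : Y, η Y ρ y = 0 ↔ y ∈ Submodule.span ℤ {x : Y | ∃ (g : K ≃ₐ[Q] K) (y' : Y), x = ρ g y' - y'}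

end Model

section Facts

variable (p : ℕ) [Fact p.Prime] (k : Type) [Field k] [CharP k p] [IsAlgClosed k]
variable (Q : Type) [Field Q] (L : Type) [Field L] [Algebra Q L] (σ : L ≃ₐ[Q] L) (eL : L ≃+* K(p, k))
variable (K : Type) [Field K] [Algebra Q K] [FiniteDimensional Q K] [IsGalois Q K]

/-- **The functorial isomorphism `f : X_*(T)_Γ → B(T)` of [K3], characterized (p. 412–413).** «In §2 of [K3] a
functorial isomorphism `f : X_*(T)_Γ → B(T)` is constructed, where `X_*(T)_Γ` denotes the coinvariants of `Γ` on
`X_*(T)`. This isomorphism of functors `X_*(·)_Γ → B(·)` can be characterized as follows: it is the unique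
homomorphism of functors `X_*(·)_Γ → B(·)` that for `𝔾_m` sends the generator `1 ∈ ℤ = X_*(𝔾_m)_Γ` to the element of
`B(𝔾_m)` represented by `p ∈ L^× = 𝔾_m(L)`. Actually [K3] deals with the category of all `ℚ_p`-tori, not just those
split by `K`, but the methods of §2 of [K3] still apply and yield the characterization above.»  Typed on the model
of `𝒯` by `Gal(K/ℚ_p)`-lattices: there exists a natural, additive, orbit-constant family `f` with `f_{𝔾_m}(1) = [p]`,
it induces bijections `X_*(T)_Γ → B(T)`, and any two such families with `f_{𝔾_m}(1) = [p]` coincide on every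
`T ∈ 𝒯`. [cite: Kottwitz1992, §12 (pp. 412–413)] [cite: Kottwitz1985Isocrystals, §2] -/
def Kottwitz1992_12_kottwitzMap_characterization : Prop :=
  IsLDatum p k Q L σ eL → ∀ (u : Lˣ), (u : L) = (p : L) →
    (∃ f : ∀ (Y : Type) [AddCommGroup Y] (ρ : Representation ℤ (K ≃ₐ[Q] K) Y), Y → BigQ Q L σ K Y ρ,
        IsNatural Q L σ K f ∧ IsAdditiveOnCoinvariants Q L σ K f ∧ IsIsoOnCoinvariants Q L σ K f ∧
          f ℤ (gmRep Q K) 1 = pClass Q L σ K u) ∧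
      ∀ f f' : ∀ (Y : Type) [AddCommGroup Y] (ρ : Representation ℤ (K ≃ₐ[Q] K) Y), Y → BigQ Q L σ K Y ρ,
        IsNatural Q L σ K f → IsAdditiveOnCoinvariants Q L σ K f → f ℤ (gmRep Q K) 1 = pClass Q L σ K u →
        IsNatural Q L σ K f' → IsAdditiveOnCoinvariants Q L σ K f' → f' ℤ (gmRep Q K) 1 = pClass Q L σ K u →
          ∀ (Y : Type) [AddCommGroup Y] [Module.Finite ℤ Y] [Module.Free ℤ Y]
            (ρ : Representation ℤ (K ≃ₐ[Q] K) Y) (y : Y), f Y ρ y = f' Y ρ y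

/-- **The reduction step in the proof of Lemma 12.1 (p. 414).** «Since `X_*(·)` is represented by
`(R_{K/ℚ_p}𝔾_m, μ_univ)`, it is enough to check that `fq` and `g` agree on `μ_univ ∈ X_*(R_{K/ℚ_p}𝔾_m)`. Consider the
norm map `R_{K/ℚ_p}𝔾_m → 𝔾_m`. It carries `μ_univ` to the element `1 ∈ ℤ = X_*(𝔾_m)`, and it induces an isomorphism
`B(R_{K/ℚ_p}𝔾_m) → B(𝔾_m)`. Therefore it is enough to check that `fq` and `g` agree on `1 ∈ ℤ = X_*(𝔾_m)`.»  Typed: two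
maps of set-valued functors `X_*(·) → B(·)` on `𝒯` that agree on `1 ∈ X_*(𝔾_m)` agree on every `T ∈ 𝒯`.
[cite: Kottwitz1992, Lemma 12.1, proof (p. 414)] -/
def Kottwitz1992_12_1_reduction : Prop :=
  IsLDatum p k Q L σ eL →
    ∀ η η' : ∀ (Y : Type) [AddCommGroup Y] (ρ : Representation ℤ (K ≃ₐ[Q] K) Y), Y → BigQ Q L σ K Y ρ,
      IsNatural Q L σ K η → IsNatural Q L σ K η' → η ℤ (gmRep Q K) 1 = η' ℤ (gmRep Q K) 1 →
        ∀ (Y : Type) [AddCommGroup Y] [Module.Finite ℤ Y] [Module.Free ℤ Y]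
          (ρ : Representation ℤ (K ≃ₐ[Q] K) Y) (y : Y), η Y ρ y = η' Y ρ y

/-- **Lemma 12.1.** «The map of functors `g : X_*(·) → B(·)` is the negative of the composition of
`q : X_*(·) → X_*(·)_Γ` and `f : X_*(·)_Γ → B(·)`.»  Here `f` is the functorial isomorphism of [K3], entered through
its printed characterization (`f_{𝔾_m}(1) = [p]`, natural, additive on coinvariants), and `g` is the map of
set-valued functors constructed on pp. 413–414 from the Fontaine–Messing functor (crystalline representations of
`Gal(ℚ̄_p/K^un)` attached to `μ ∈ X_*(T)` ↦ `Φ`-isocrystal ↦ `b ∈ T(L)`, `Φ_V = b_V σ`), entered through naturality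
and the printed outcome of that construction on the Tate object: «we get the Tate object `ℚ_p(1)` … and since `Φ`
is given by `p⁻¹σ` for the Tate object, we conclude that `b` is represented by `p⁻¹ ∈ 𝔾_m(L)`», i.e.
`g_{𝔾_m}(1) = [p⁻¹] = -[p]`.  Conclusion: `g_T = -(f_T ∘ q_T)` for every `T ∈ 𝒯` (additive notation in `B(T)`).
-- TODO(general form): the construction of `g` (pp. 413–414) is not typed — no Mathlib notion of crystalline
-- representations or of the Fontaine–Messing functor; only its value on `𝔾_m` enters, as printed.
[cite: Kottwitz1992, Lemma 12.1 (p. 414)] -/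
def Kottwitz1992_12_1 : Prop :=
  IsLDatum p k Q L σ eL → ∀ (u : Lˣ), (u : L) = (p : L) →
    ∀ f g : ∀ (Y : Type) [AddCommGroup Y] (ρ : Representation ℤ (K ≃ₐ[Q] K) Y), Y → BigQ Q L σ K Y ρ,
      IsNatural Q L σ K f → IsAdditiveOnCoinvariants Q L σ K f → f ℤ (gmRep Q K) 1 = pClass Q L σ K u →
      IsNatural Q L σ K g → g ℤ (gmRep Q K) 1 = -pClass Q L σ K u →
        ∀ (Y : Type) [AddCommGroup Y] [Module.Finite ℤ Y] [Module.Free ℤ Y]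
          (ρ : Representation ℤ (K ≃ₐ[Q] K) Y) (y : Y), g Y ρ y = -f Y ρ y

end Facts

end Literature.NumberTheory.Kottwitz1992.FunctorialIsomorphisms
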